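import Summits.CriticalPhenomena.PercolationContinuityZ3.Theorems.PercNearOneGluingNoHeavyQuantScaleDefectAllAspects
import HarnessLib

/-!
# BCKS's hypothesis fails above six dimensions at EVERY aspect, and annuli of POLYNOMIALLY GROWING aspect
# are still crossed — corollaries of the all-aspect second-moment bound

PAPER-2 track (i), ARM-3 (the power-law landmark; barrier placement BC8), gen 6.
builds on p205010 (kernel theorem, internal audit signed; external expert review pending).

Sequel of `…QuantScaleDefectAllAspects.lean` (`Quant.one_sub_real_boxCrossing_le_of_twoPoint`:
`1 − P_{p_c}(Λ_n ↔ ∂ⁱⁿΛ_N in Λ_N) ≤ K n²(N+n)⁴/(2n+1)^d` under the upper two-point bound and the one-arm lower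
bound; `Quant.not_scaleDefectAt_of_twoPointBoundedRatio`: `X_B(λ)` fails for every `λ ≥ 1`, `d ≥ 7`).

* **`Quant.not_slabCrossingBound_of_twoPointBoundedRatio`** — for `d ≥ 7` under `TwoPointBoundedRatio d`, BCKS's
  uniform slab-crossing bound `SlabCrossingBound d p_c b ε` FAILS for EVERY aspect `b ≥ 1` and every `ε > 0`
  (the tree had `b = 3`: `not_slabCrossingBound_three_of_six_lt`); **`…_allAspects_eventually`** — unconditionally
  for all `d ≥ D` (`∃ D > 6`); `…_allAspects_of_ten_pow_fifty_le`; `Quant.not_forall_slabCrossingBound_aspect`.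
* **`Quant.boxCrossing_tendsto_one_of_polynomialAspect`** — for `d ≥ 7` under `TwoPointBoundedRatio d`, even annuli
  whose outer scale grows POLYNOMIALLY, `n ≤ L(n) ≤ A n^a` with `1 ≤ a < (d − 2)/4`, are crossed with probability
  `→ 1`: `P_{p_c}(boxCrossing d n (L n)) → 1`; hence `Quant.not_scaleDefectAt_of_polynomialAspect`.  (At `d = 7`:
  every `a < 5/4`; the admissible growth improves linearly with `d`.)

Honest placement: house corollaries of classical ingredients (BK, Aizenman's second-moment method, Kozma–Nachmias's
one-arm lower bound, Hara–Slade/Hara for the unconditional forms); barrier statements, not rates for `d = 3`.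
-/

noncomputable section

open scoped ENNReal

namespace Summit.CriticalPhenomena.PercolationContinuityZ3.Theorems.Quant

open MeasureTheory Filter Topology
open Literature.Probability.Percolation Literature.Probability.LatticeModels
open Summit.CriticalPhenomena.PercolationContinuityZ3.Theorems.SurfaceTension
open Literature.Barriers.CriticalPhenomena

variable {d : ℕ}

/-! ### BCKS's hypothesis at every aspect -/

/-- **BCKS's hypothesis fails above six dimensions at EVERY aspect**: for `d ≥ 7` with `TwoPointBoundedRatio d`,
`b ≥ 1` and `ε > 0`, `¬ SlabCrossingBound d p_c b ε` (`SlabCrossingBound ⟹ ScaleDefectAt (b·) (ε^{2d})`, which fails at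
every aspect). [cite: BorgsChayesKestenSpencer1999, title theorem] [cite: Aizenman1997, Thm. 4] [cite: KozmaNachmias2011, Thm. 1] -/
theorem not_slabCrossingBound_of_twoPointBoundedRatio [NeZero d] (hd : 7 ≤ d) (hτ : TwoPointBoundedRatio d)
    {b : ℕ} (hb : 1 ≤ b) {ε : ℝ} (hε : 0 < ε) : ¬ SlabCrossingBound d (criticalProbI d) b ε := fun h =>
  not_scaleDefectAt_of_twoPointBoundedRatio hd hτ hb (pow_pos hε _) (scaleDefectAt_of_slabCrossingBound hb hε.le h)

/-- **BCKS's hypothesis fails at EVERY aspect for all sufficiently large `d`, UNCONDITIONALLY**: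
`∃ D > 6, ∀ d ≥ D, ∀ b ≥ 1, ∀ ε > 0, ¬ SlabCrossingBound d p_c b ε`.  Standard axioms, no named fact.
[cite: BorgsChayesKestenSpencer1999, title theorem] [cite: Aizenman1997, Thm. 4] [cite: Hara2008, Thm. 1.1] -/
theorem not_slabCrossingBound_allAspects_eventually :
    ∃ D : ℕ, 6 < D ∧ ∀ (d : ℕ) [NeZero d], D ≤ d → ∀ b : ℕ, 1 ≤ b → ∀ ε : ℝ, 0 < ε →
      ¬ SlabCrossingBound d (criticalProbI d) b ε := by
  obtain ⟨D, hD, h⟩ := twoPointBoundedRatio_eventually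
  exact ⟨max D 7, lt_of_lt_of_le hD (le_max_left _ _), fun d _ hd b hb ε hε =>
    not_slabCrossingBound_of_twoPointBoundedRatio (le_trans (le_max_right _ _) hd)
      (h d (le_trans (le_max_left _ _) hd)) hb hε⟩

/-- **BCKS's hypothesis fails at EVERY aspect for every `d ≥ 10⁵⁰`, unconditionally** (explicit threshold of the
formal Hara–Slade proof). [cite: BorgsChayesKestenSpencer1999, title theorem] [cite: Hara2008, Thm. 1.1] -/
theorem not_slabCrossingBound_allAspects_of_ten_pow_fifty_le [NeZero d] (hd : 10 ^ 50 ≤ d) {b : ℕ} (hb : 1 ≤ b)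
    {ε : ℝ} (hε : 0 < ε) : ¬ SlabCrossingBound d (criticalProbI d) b ε :=
  not_slabCrossingBound_of_twoPointBoundedRatio (le_trans (by norm_num) hd)
    (twoPointBoundedRatio_of_haraSladeThreshold_le (le_trans (by norm_num) hd)) hb hε

/-- **No dimension-uniform BCKS hypothesis at ANY aspect**: for every `b ≥ 1` it is FALSE that every `d ≥ 2`
admits `ε > 0` with `SlabCrossingBound d p_c b ε`.  Unconditional.
[cite: BorgsChayesKestenSpencer1999, title theorem] [cite: Aizenman1997, Thm. 4] -/
theorem not_forall_slabCrossingBound_aspect {b : ℕ} (hb : 1 ≤ b) :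
    ¬ ∀ (d : ℕ) [NeZero d], 2 ≤ d → ∃ ε : ℝ, 0 < ε ∧ SlabCrossingBound d (criticalProbI d) b ε := by
  intro hall
  obtain ⟨D, hD, h⟩ := not_slabCrossingBound_allAspects_eventually
  haveI : NeZero D := ⟨by omega⟩
  obtain ⟨ε, hε, hB⟩ := hall D (by omega)
  exact h D le_rfl b hb ε hε hB

/-! ### Polynomially growing aspect -/

/-- **Annuli of polynomially growing aspect are crossed above six dimensions**: for `d ≥ 7` with
`TwoPointBoundedRatio d`, and scales `n ≤ L(n) ≤ A n^a` (`n ≥ 1`) with `1 ≤ a` and `4a < d − 2`: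
`P_{p_c}(boxCrossing d n (L n)) → 1`.  From `1 − P ≤ K n²(L n + n)⁴/(2n+1)^d ≤ K (A+1)⁴ n^{−(d−2−4a)}`.
[cite: Aizenman1997, Thm. 4] [cite: KozmaNachmias2011, Thm. 1 (lower bound)] -/
theorem boxCrossing_tendsto_one_of_polynomialAspect (hd : 7 ≤ d) (hτ : TwoPointBoundedRatio d)
    {L : ℕ → ℕ} {A a : ℝ} (hA : 0 ≤ A) (ha1 : 1 ≤ a) (ha : 4 * a < (d : ℝ) - 2)
    (hL1 : ∀ n : ℕ, n ≤ L n) (hL2 : ∀ n : ℕ, 1 ≤ n → (L n : ℝ) ≤ A * (n : ℝ) ^ a) :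
    Tendsto (fun n : ℕ => (bondPercolation (zdGraph d) (criticalProbI d)).real (boxCrossing d n (L n)))
      atTop (𝓝 1) := by
  obtain ⟨C', C, hC', hC'C, hb⟩ := hτ.natPow (by omega)
  obtain ⟨c, hc, hπ⟩ := hτ.oneArmProb_lower (by omega)
  obtain ⟨K, hK, hbound⟩ := one_sub_real_boxCrossing_le_of_twoPoint (d := d) (by omega) (hC'.le.trans hC'C) hc
    (fun x y hxy => (hb x y hxy).2) hπ
  set μ := bondPercolation (zdGraph d) (criticalProbI d) with hμ
  set b : ℝ := (d : ℝ) - 2 - 4 * a with hbdef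
  have hb0 : 0 < b := by rw [hbdef]; linarith
  -- the error term `K (A+1)⁴ n^{-b}` tends to `0`
  have herr : Tendsto (fun n : ℕ => K * (A + 1) ^ 4 * (n : ℝ) ^ (-b)) atTop (𝓝 0) := by
    have h := ((tendsto_rpow_neg_atTop hb0).comp tendsto_natCast_atTop_atTop).const_mul (K * (A + 1) ^ 4)
    rw [mul_zero] at h
    exact h
  have hle : ∀ᶠ n : ℕ in atTop, 1 - K * (A + 1) ^ 4 * (n : ℝ) ^ (-b) ≤ μ.real (boxCrossing d n (L n)) := by
    filter_upwards [Filter.eventually_ge_atTop 1] with n hn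
    have hn0 : (0 : ℝ) < n := by exact_mod_cast hn
    have hn1 : (1 : ℝ) ≤ n := by exact_mod_cast hn
    have h := hbound n (L n) hn (hL1 n)
    -- `L n + n ≤ (A + 1) n^a`
    have hna : (n : ℝ) ≤ (n : ℝ) ^ a := Real.self_le_rpow_of_one_le hn1 ha1
    have hLn : (L n : ℝ) + n ≤ (A + 1) * (n : ℝ) ^ a := by
      have := hL2 n hn
      nlinarith
    have hLn0 : 0 ≤ (L n : ℝ) + n := by positivity
    have hpow4 : ((L n : ℝ) + n) ^ 4 ≤ (A + 1) ^ 4 * ((n : ℝ) ^ a) ^ 4 := by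
      rw [← mul_pow]; exact pow_le_pow_left₀ hLn0 hLn 4
    -- `(2n+1)^d ≥ n^d`
    have hden : (n : ℝ) ^ d ≤ (2 * (n : ℝ) + 1) ^ d := pow_le_pow_left₀ hn0.le (by linarith) d
    -- assemble: `n² (L n + n)⁴ / (2n+1)^d ≤ (A+1)⁴ n^{2 + 4a - d} = (A+1)⁴ n^{-b}`
    have hrpow : (n : ℝ) ^ 2 * ((n : ℝ) ^ a) ^ 4 / (n : ℝ) ^ d = (n : ℝ) ^ (-b) := by
      rw [hbdef]
      rw [← Real.rpow_natCast ((n : ℝ) ^ a) 4, ← Real.rpow_mul hn0.le, ← Real.rpow_natCast (n : ℝ) 2,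
        ← Real.rpow_natCast (n : ℝ) d, ← Real.rpow_add hn0, ← Real.rpow_sub hn0]
      congr 1
      push_cast
      ring
    have hcmp : K * ((n : ℝ) ^ 2 * ((L n : ℝ) + n) ^ 4 / (2 * (n : ℝ) + 1) ^ d) ≤
        K * (A + 1) ^ 4 * (n : ℝ) ^ (-b) := by
      rw [mul_assoc]
      refine mul_le_mul_of_nonneg_left ?_ hK.le
      calc (n : ℝ) ^ 2 * ((L n : ℝ) + n) ^ 4 / (2 * (n : ℝ) + 1) ^ d
          ≤ (n : ℝ) ^ 2 * ((A + 1) ^ 4 * ((n : ℝ) ^ a) ^ 4) / (n : ℝ) ^ d := by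
            gcongr
        _ = (A + 1) ^ 4 * ((n : ℝ) ^ 2 * ((n : ℝ) ^ a) ^ 4 / (n : ℝ) ^ d) := by ring
        _ = (A + 1) ^ 4 * (n : ℝ) ^ (-b) := by rw [hrpow]
    linarith
  have hlow : Tendsto (fun n : ℕ => 1 - K * (A + 1) ^ 4 * (n : ℝ) ^ (-b)) atTop (𝓝 1) := by
    have := herr.const_sub 1
    rw [sub_zero] at this
    exact this
  exact tendsto_of_tendsto_of_tendsto_of_le_of_le' hlow tendsto_const_nhds hle
    (Filter.Eventually.of_forall fun n => measureReal_le_one)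

/-- **No crossing defect along polynomially growing scales above six dimensions**: for `d ≥ 7` with
`TwoPointBoundedRatio d`, `n ≤ L(n) ≤ A n^a` (`1 ≤ a`, `4a < d − 2`) and `η > 0`: `¬ ScaleDefectAt d p_c L η`.
[cite: Aizenman1997, Thm. 4] [cite: KozmaNachmias2011, Thm. 1 (lower bound)] -/
theorem not_scaleDefectAt_of_polynomialAspect (hd : 7 ≤ d) (hτ : TwoPointBoundedRatio d)
    {L : ℕ → ℕ} {A a : ℝ} (hA : 0 ≤ A) (ha1 : 1 ≤ a) (ha : 4 * a < (d : ℝ) - 2)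
    (hL1 : ∀ n : ℕ, n ≤ L n) (hL2 : ∀ n : ℕ, 1 ≤ n → (L n : ℝ) ≤ A * (n : ℝ) ^ a) {η : ℝ} (hη : 0 < η) :
    ¬ ScaleDefectAt d (criticalProbI d) L η := by
  intro h
  have ht := boxCrossing_tendsto_one_of_polynomialAspect hd hτ hA ha1 ha hL1 hL2
  have hev : ∀ᶠ n : ℕ in atTop,
      (bondPercolation (zdGraph d) (criticalProbI d)).real (boxCrossing d n (L n)) ≤ 1 - η :=
    Filter.eventually_atTop.2 ⟨1, fun n hn => h n hn⟩
  have := le_of_tendsto ht hev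
  linarith

end Summit.CriticalPhenomena.PercolationContinuityZ3.Theorems.Quant

end
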